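import Summits.Parity.GeneralizedHardyLittlewood.Theorems.LeeYangFibresAbsoluteUpgradeDipDefs
import Summits.Parity.GeneralizedHardyLittlewood.Theorems.LeeYangFibresModelHyperbolicityCalculus
import Summits.Parity.GeneralizedHardyLittlewood.Theorems.LeeYangFibresModelHyperbolicityCellRate
import Summits.Parity.GeneralizedHardyLittlewood.Theorems.LeeYangFibresModelCellFactsDensityBounds
import HarnessLib

/-!
# Route `LeeYangFibres`, crux `AbsoluteUpgrade` (stmt-Parity-14116), line `dip-margin-rate-exchange`:
# the bridge from the `(X, Y)`-format cell asymptotics to one cell along the schedule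
# (helper for the stub `stub_anatomyAlong`)

Helper file for the registered stub `stub_anatomyAlong : AnatomyAlong`.  Two parity-free facts about the
Alladi–Buchstab densities `I_{j+1} = cellDensity j` and the model cells `A_m(N) = cell u N m`:

* `anatomyAlong_densityLower` — the LOWER bound `I_{j+1}(u) ≥ ((u−1−j)/(u−1))^j / j!` for real
  `u ≥ j + 1` (induction on `j` over the recursion `I_{j+2}(u) = ∫_1^{u−1} I_{j+1}(t) dt/t`, restricting
  to `t ∈ [j+1, u−1]` and bounding `(t−1)^j t ≤ (u−1)^{j+1}`), hence `I_{j+1}(u) ≥ 1/(u^u)²` for natural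
  `u ≥ j + 2` (`anatomyAlong_densityLower_nat`);
* `anatomyAlong_bridge` (registered helper) — given Alladi's cell asymptotics with an explicit constant
  `A^{i+k+1}` in the tree's `(X, Y)`-format (the conclusion of `anatomyAlong_explicitCellRate` of the
  stub file `LeeYangFibresAbsoluteUpgradeAnatomyAlong.lean`, taken here as a HYPOTHESIS), for `u ≥ 4`,
  `N ≥ 16`, `u² ≤ log N` and `1 ≤ m ≤ u`:
  `|A_m(N) log N/N − I_m(u)| ≤ 3 A^{2u} u²/log N`.
  Proof: `cell u N m = omegaCell Y N m` with the integer threshold `Y = ⌊N^{1/u}⌋₊ + 1`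
  (`cell_eq_omegaCell`, `omegaCell_succ_eq_card_filter`), the rate bound at `(X, Y) = (N, Y)`, `k = u`
  (`log N ≤ u log Y`), multiplied by `log N/N`; with `v = log N/log Y` one has `0 ≤ u − v ≤ u²/log N`
  (`log Y ≤ log N/u + 1`), so the main error is `A^{m+u} log N/log² Y ≤ A^{2u} u²/log N`, the prime
  secondary term is `(Y/log Y)(log N/N) ≤ uY/N ≤ u²/log N` (`Y log N ≤ 8 √N ≤ 4N`), and the density moves
  from `v` to `u` at cost `≤ u − v` by the mean value theorem (`|I_{j+2}'(s)| = I_{j+1}(s−1)/(s−1) ≤ 1`).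

References: K. Alladi, Quart. J. Math. Oxford (2) 33 (1982) 129–148 [Alladi1982]; G. Tenenbaum,
*Introduction to analytic and probabilistic number theory*, III.6 [Tenenbaum2015].
-/

noncomputable section

namespace Summit.Parity.GeneralizedHardyLittlewood.Cruxes.AbsoluteUpgrade.DipMarginRateExchange

open scoped BigOperators
open MeasureTheory
open Literature.NumberTheory.Sieve
open Summit.Parity.GeneralizedHardyLittlewood.Cruxes.ModelHyperbolicity.WindowChainTransport
open Summit.Parity.GeneralizedHardyLittlewood.Theorems.ModelHyperbolicity.Negative (cell)
open Summit.Parity.GeneralizedHardyLittlewood.Theorems.ModelCellFacts (cellDensity_le_pow_div_factorial)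

/-! ## The lower bound for the densities -/

/-- **Lower bound**: `(u − 1 − j)^j / (j! (u−1)^j) ≤ I_{j+1}(u)` for real `u ≥ j + 1` (induction on `j`:
restrict the recursion `I_{j+2}(u) = ∫_1^{u−1} I_{j+1}(t) dt/t` to `t ∈ [j+1, u−1]`, where
`I_{j+1}(t)/t ≥ (t−1−j)^j/(j! (t−1)^j t) ≥ (t−1−j)^j/(j! (u−1)^{j+1})`, and integrate
`∫_{j+1}^{u−1} (t−1−j)^j dt = (u−2−j)^{j+1}/(j+1)`). -/
theorem anatomyAlong_densityLower (j : ℕ) :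
    ∀ u : ℝ, (j : ℝ) + 1 ≤ u →
      (u - 1 - j) ^ j / ((j.factorial : ℝ) * (u - 1) ^ j) ≤ cellDensity j u := by
  induction j with
  | zero => intro u _; simp
  | succ j ih =>
    intro u hu
    push_cast at hu ⊢
    set a : ℝ := (j : ℝ) + 1 with ha
    set b : ℝ := u - 1 with hb
    have hj0 : (0 : ℝ) ≤ j := Nat.cast_nonneg j
    have ha1 : 1 ≤ a := by rw [ha]; linarith
    have hab : a ≤ b := by rw [ha, hb]; linarith
    have hb1 : 1 ≤ b := ha1.trans hab
    have hmax : max (u - 1) 1 = b := max_eq_left hb1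
    rw [calc_cellDensity_succ, hmax]
    -- integrability of the true integrand on `[1, ∞)`
    have hcont : ContinuousOn (fun t => cellDensity j t / t) (Set.Ici 1) :=
      (calc_continuous j).continuousOn.div continuousOn_id fun t ht =>
        (lt_of_lt_of_le one_pos (show (1 : ℝ) ≤ t from ht)).ne'
    have hint : ∀ c d : ℝ, 1 ≤ c → 1 ≤ d →
        IntervalIntegrable (fun t => cellDensity j t / t) volume c d := by
      intro c d hc hd
      refine (hcont.mono ?_).intervalIntegrable
      intro t ht
      rw [Set.mem_uIcc] at ht
      rcases ht with h | h
      · exact le_trans hc h.1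
      · exact le_trans hd h.1
    have hsplit : ∫ t in (1 : ℝ)..b, cellDensity j t / t =
        (∫ t in (1 : ℝ)..a, cellDensity j t / t) + ∫ t in a..b, cellDensity j t / t :=
      (intervalIntegral.integral_add_adjacent_intervals (hint 1 a le_rfl ha1) (hint a b ha1 hb1)).symm
    have hfirst : 0 ≤ ∫ t in (1 : ℝ)..a, cellDensity j t / t :=
      intervalIntegral.integral_nonneg ha1 fun t ht => div_nonneg (calc_nonneg j t) (by linarith [ht.1])
    -- the comparison integrand `K (t - a)^j`, `K = 1/(j! (u-1)^{j+1})`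
    have hu1 : 0 < u - 1 := by linarith
    set K : ℝ := 1 / ((j.factorial : ℝ) * (u - 1) ^ (j + 1)) with hK
    have hgi : IntervalIntegrable (fun t => K * (t - a) ^ j) volume a b :=
      (continuous_const.mul ((continuous_id.sub continuous_const).pow j)).intervalIntegrable _ _
    have hmono : ∫ t in a..b, K * (t - a) ^ j ≤ ∫ t in a..b, cellDensity j t / t := by
      refine intervalIntegral.integral_mono_on hab hgi (hint a b ha1 hb1) fun t ht => ?_
      have ht1 : a ≤ t := ht.1
      have htb : t ≤ b := ht.2
      rw [ha] at ht1
      rw [hb] at htb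
      have ht0 : 0 < t := by linarith
      have htm : 0 ≤ t - 1 := by linarith
      have hIH := ih t ht1
      have hpos : 0 < (j.factorial : ℝ) * (t - 1) ^ j * t := by
        rcases Nat.eq_zero_or_pos j with rfl | hj
        · simpa using ht0
        · have h1j : (1 : ℝ) ≤ j := by exact_mod_cast hj
          have ht1' : 0 < t - 1 := by linarith
          positivity
      have hnum : 0 ≤ (t - 1 - j) ^ j := pow_nonneg (by linarith) _
      calc K * (t - a) ^ j = (t - 1 - j) ^ j / ((j.factorial : ℝ) * (u - 1) ^ j * (u - 1)) := by
            rw [hK, ha, pow_succ]; ring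
        _ ≤ (t - 1 - j) ^ j / ((j.factorial : ℝ) * (t - 1) ^ j * t) := by
            refine div_le_div_of_nonneg_left hnum hpos ?_
            have h1 : (t - 1) ^ j ≤ (u - 1) ^ j := pow_le_pow_left₀ htm (by linarith) _
            have hf0 : (0 : ℝ) ≤ j.factorial := Nat.cast_nonneg _
            calc (j.factorial : ℝ) * (t - 1) ^ j * t ≤ (j.factorial : ℝ) * (u - 1) ^ j * t := by gcongr
              _ ≤ (j.factorial : ℝ) * (u - 1) ^ j * (u - 1) := by gcongr
        _ = (t - 1 - j) ^ j / ((j.factorial : ℝ) * (t - 1) ^ j) / t := by rw [div_div]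
        _ ≤ cellDensity j t / t := div_le_div_of_nonneg_right hIH ht0.le
    -- the comparison integral evaluates to `K (b - a)^{j+1}/(j+1)`
    have hval : ∫ t in a..b, K * (t - a) ^ j = K * ((b - a) ^ (j + 1) / (j + 1)) := by
      rw [intervalIntegral.integral_const_mul, intervalIntegral.integral_comp_sub_right (fun t => t ^ j) a,
        integral_pow, sub_self, zero_pow (Nat.succ_ne_zero j), sub_zero]
    have hfac : (((j + 1).factorial : ℕ) : ℝ) = ((j : ℝ) + 1) * j.factorial := by
      rw [Nat.factorial_succ]; push_cast; ring
    have hf0 : (0 : ℝ) < j.factorial := by exact_mod_cast j.factorial_pos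
    calc (u - 1 - ((j : ℝ) + 1)) ^ (j + 1) / ((((j + 1).factorial : ℕ) : ℝ) * (u - 1) ^ (j + 1))
        = K * ((b - a) ^ (j + 1) / (j + 1)) := by
          rw [hfac, hK, ha, hb]
          field_simp
      _ = ∫ t in a..b, K * (t - a) ^ j := hval.symm
      _ ≤ ∫ t in a..b, cellDensity j t / t := hmono
      _ ≤ _ := by rw [hsplit]; linarith

/-- **Lower bound at natural arguments**: `1/(u^u)² ≤ I_{j+1}(u)` for natural `u ≥ j + 2`
(`anatomyAlong_densityLower` with `u − 1 − j ≥ 1`, `j! ≤ j^j ≤ u^u` and `(u−1)^j ≤ u^u`). -/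
theorem anatomyAlong_densityLower_nat {j u : ℕ} (hju : j + 2 ≤ u) :
    1 / ((u : ℝ) ^ u) ^ 2 ≤ cellDensity j u := by
  have hu1 : 1 ≤ u := by omega
  have hu1' : (1 : ℝ) ≤ u := by exact_mod_cast hu1
  have hju' : (j : ℝ) + 2 ≤ u := by exact_mod_cast hju
  have hlow := anatomyAlong_densityLower j u (by linarith)
  refine le_trans ?_ hlow
  have hf0 : (0 : ℝ) < j.factorial := by exact_mod_cast j.factorial_pos
  have hden : 0 < (j.factorial : ℝ) * ((u : ℝ) - 1) ^ j := by
    have : (0 : ℝ) < (u : ℝ) - 1 := by linarith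
    positivity
  -- numerator ≥ 1
  have hnum : 1 ≤ ((u : ℝ) - 1 - j) ^ j := one_le_pow₀ (by linarith)
  -- denominator ≤ (u^u)²
  have hfac : (j.factorial : ℝ) ≤ (u : ℝ) ^ u := by
    have h1 : ((j.factorial : ℕ) : ℝ) ≤ ((j ^ j : ℕ) : ℝ) := by exact_mod_cast Nat.factorial_le_pow j
    have h2 : ((j ^ j : ℕ) : ℝ) = (j : ℝ) ^ j := by push_cast; ring
    have h3 : (j : ℝ) ^ j ≤ (u : ℝ) ^ j := pow_le_pow_left₀ (Nat.cast_nonneg j) (by linarith) j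
    have h4 : (u : ℝ) ^ j ≤ (u : ℝ) ^ u := pow_le_pow_right₀ hu1' (by omega)
    linarith
  have hpow : ((u : ℝ) - 1) ^ j ≤ (u : ℝ) ^ u :=
    (pow_le_pow_left₀ (by linarith) (by linarith) j).trans (pow_le_pow_right₀ hu1' (by omega))
  have hden2 : (j.factorial : ℝ) * ((u : ℝ) - 1) ^ j ≤ ((u : ℝ) ^ u) ^ 2 := by
    rw [sq]; exact mul_le_mul hfac hpow (pow_nonneg (by linarith) _) (by positivity)
  calc 1 / ((u : ℝ) ^ u) ^ 2 ≤ 1 / ((j.factorial : ℝ) * ((u : ℝ) - 1) ^ j) :=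
        one_div_le_one_div_of_le hden hden2
    _ ≤ ((u : ℝ) - 1 - j) ^ j / ((j.factorial : ℝ) * ((u : ℝ) - 1) ^ j) :=
        div_le_div_of_nonneg_right hnum hden.le

/-! ## The bridge: one cell along the schedule -/

/-- `|I_{j+1}(s)/s| ≤ 1` for `s ≥ 1` (`I_{j+1}(s) ≤ (log s)^j/j! ≤ s`). -/
theorem anatomyAlong_abs_cellDensity_div_le_one (j : ℕ) {s : ℝ} (hs : 1 ≤ s) :
    |cellDensity j s / s| ≤ 1 := by
  have hs0 : 0 < s := by linarith
  have h1 := cellDensity_le_pow_div_factorial j s hs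
  have h2 := Real.pow_div_factorial_le_exp (Real.log s) (Real.log_nonneg hs) j
  rw [Real.exp_log hs0] at h2
  rw [abs_div, abs_of_pos hs0, abs_of_nonneg (calc_nonneg j s), div_le_one hs0]
  exact h1.trans h2

/-- **The bridge (registered helper `anatomyAlong_bridge`).** Assume Alladi's cell asymptotics in the
tree's `(X, Y)`-format with the explicit constant `A^{i+k+1}` (`A ≥ 2`).  Then for natural `u ≥ 4`,
`N ≥ 16` with `u² ≤ log N` and `1 ≤ m ≤ u`:
`|A_m(N) · log N/N − I_m(u)| ≤ 3 A^{2u} u²/log N`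
(rate bound at `X = N`, `Y = ⌊N^{1/u}⌋₊ + 1`, `k = u`, multiplied by `log N/N`; the secondary prime term,
present only for `m = 1`, is `≤ uY/N ≤ u²/log N`; the density is moved from `v = log N/log Y` to `u`,
`0 ≤ u − v ≤ u²/log N`, by the mean value theorem with `|I_{m}'| ≤ 1` on `[3, ∞)`).  The statement is
written on one line, verbatim as registered (`ledger workitem stub-add`). -/
theorem anatomyAlong_bridge : ∀ {A : ℝ}, 2 ≤ A → (∀ i k : ℕ, ∀ X Y : ℝ, 2 ≤ Y → Y ≤ X → Real.log X ≤ k * Real.log Y → |((((roughIcc ⌈Y⌉₊ ⌊X⌋₊).filter (fun b => ArithmeticFunction.cardFactors b = i + 1)).card : ℕ) : ℝ) - (X * cellDensity i (Real.log X / Real.log Y) / Real.log X - if i = 0 then Y / Real.log Y else 0)| ≤ A ^ (i + k + 1) * X / Real.log Y ^ 2) → ∀ {u N m : ℕ}, 4 ≤ u → 16 ≤ N → (u : ℝ) ^ 2 ≤ Real.log N → 1 ≤ m → m ≤ u → |(cell u N m : ℝ) * Real.log N / N - cellDensity (m - 1) u| ≤ 3 * A ^ (2 * u) * (u : ℝ)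 ^ 2 / Real.log N := by
  intro A hA hR u N m hu hN huN hm hmu
  obtain ⟨i, rfl⟩ : ∃ i, m = i + 1 := ⟨m - 1, by omega⟩
  rw [Nat.add_sub_cancel]
  -- basic real quantities
  have hN16 : (16 : ℝ) ≤ N := by exact_mod_cast hN
  have hN0 : (0 : ℝ) < N := by linarith
  have hN1 : (1 : ℝ) ≤ N := by linarith
  have hu4 : (4 : ℝ) ≤ u := by exact_mod_cast hu
  have hu0 : (0 : ℝ) < u := by linarith
  have hA1 : (1 : ℝ) ≤ A := by linarith
  have hL0 : 0 < Real.log N := Real.log_pos (by linarith)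
  -- the threshold `Y = ⌊N^{1/u}⌋₊ + 1`
  set r : ℝ := (N : ℝ) ^ ((1 : ℝ) / u) with hr
  set Yn : ℕ := ⌊r⌋₊ + 1 with hYn
  set Y : ℝ := (Yn : ℝ) with hY
  have hr1 : 1 ≤ r := Real.one_le_rpow hN1 (by positivity)
  have hr0 : 0 < r := by linarith
  have hrY : r < Y := by rw [hY, hYn]; push_cast; exact Nat.lt_floor_add_one r
  have hYr : Y ≤ r + 1 := by rw [hY, hYn]; push_cast; linarith [Nat.floor_le hr0.le]
  have hY2 : 2 ≤ Y := by
    have h1 : 1 ≤ ⌊r⌋₊ := (Nat.one_le_floor_iff _).mpr hr1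
    rw [hY, hYn]
    exact_mod_cast (show 2 ≤ ⌊r⌋₊ + 1 by omega)
  have hY0 : 0 < Y := by linarith
  have hlogr : Real.log r = Real.log N / u := by
    rw [hr, Real.log_rpow hN0]; ring
  have hLu0 : 0 < Real.log N / u := div_pos hL0 hu0
  have hℓ1 : Real.log N / u < Real.log Y := by rw [← hlogr]; exact Real.log_lt_log hr0 hrY
  have hℓ0 : 0 < Real.log Y := hLu0.trans hℓ1
  have hℓ2 : Real.log Y ≤ Real.log N / u + 1 := by
    have h1 : Real.log Y ≤ Real.log (r + 1) := Real.log_le_log hY0 hYr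
    have h2 : Real.log (r + 1) - Real.log r ≤ 1 := by
      rw [← Real.log_div (by linarith) hr0.ne']
      have h3 := Real.log_le_sub_one_of_pos (show 0 < (r + 1) / r by positivity)
      have h4 : (r + 1) / r - 1 = 1 / r := by field_simp; ring
      have h5 : 1 / r ≤ 1 := by rw [div_le_one hr0]; exact hr1
      linarith
    linarith [hlogr]
  have hLuℓ : Real.log N ≤ u * Real.log Y := ((div_lt_iff₀' hu0).mp hℓ1).le
  have hv_le : Real.log N / Real.log Y ≤ u := by rw [div_le_iff₀ hℓ0]; exact hLuℓ
  -- `Y ≤ N`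
  have hYN : Y ≤ N := by
    have hexp : (1 : ℝ) / u < 1 := by rw [div_lt_one hu0]; linarith
    have hlt : r < N := by
      have h := Real.rpow_lt_rpow_of_exponent_lt (show (1 : ℝ) < N by linarith) hexp
      rwa [Real.rpow_one] at h
    have hfl : ⌊r⌋₊ < N := (Nat.floor_lt hr0.le).mpr hlt
    rw [hY, hYn]; exact_mod_cast hfl
  -- the rate bound at `(X, Y) = (N, Y)`, `k = u`
  have hRate := hR i u N Y hY2 hYN hLuℓ
  have hceil : ⌈Y⌉₊ = Yn := by rw [hY, Nat.ceil_natCast]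
  have hcell : ((((roughIcc ⌈Y⌉₊ ⌊(N : ℝ)⌋₊).filter
      (fun b => ArithmeticFunction.cardFactors b = i + 1)).card : ℕ) : ℝ) = (cell u N (i + 1) : ℝ) := by
    rw [hceil, Nat.floor_natCast, ← omegaCell_succ_eq_card_filter, cell_eq_omegaCell]
  rw [hcell] at hRate
  -- sizes of the three error terms
  have hE1 : A ^ (i + u + 1) * Real.log N / Real.log Y ^ 2 ≤ A ^ (2 * u) * (u : ℝ) ^ 2 / Real.log N := by
    have hpow : A ^ (i + u + 1) ≤ A ^ (2 * u) := pow_le_pow_right₀ hA1 (by omega)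
    have hℓsq : (Real.log N / u) ^ 2 ≤ Real.log Y ^ 2 := pow_le_pow_left₀ hLu0.le hℓ1.le 2
    have h1 : Real.log N / Real.log Y ^ 2 ≤ Real.log N / (Real.log N / u) ^ 2 :=
      div_le_div_of_nonneg_left hL0.le (by positivity) hℓsq
    have h2 : Real.log N / (Real.log N / u) ^ 2 = (u : ℝ) ^ 2 / Real.log N := by
      field_simp
    calc A ^ (i + u + 1) * Real.log N / Real.log Y ^ 2
        = A ^ (i + u + 1) * (Real.log N / Real.log Y ^ 2) := mul_div_assoc _ _ _
      _ ≤ A ^ (2 * u) * ((u : ℝ) ^ 2 / Real.log N) := by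
          rw [← h2]; exact mul_le_mul hpow h1 (by positivity) (by positivity)
      _ = A ^ (2 * u) * (u : ℝ) ^ 2 / Real.log N := (mul_div_assoc _ _ _).symm
  have hE2 : Y / Real.log Y * Real.log N / N ≤ (u : ℝ) ^ 2 / Real.log N := by
    -- `Y log N ≤ 8 √N ≤ 4 N ≤ u N`
    have hr4 : r ≤ (N : ℝ) ^ ((1 : ℝ) / 4) := by
      rw [hr]; exact Real.rpow_le_rpow_of_exponent_le hN1 (one_div_le_one_div_of_le four_pos hu4)
    have hL4 : Real.log N ≤ 4 * (N : ℝ) ^ ((1 : ℝ) / 4) := by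
      have h := Real.log_le_rpow_div hN0.le (show (0 : ℝ) < 1 / 4 by norm_num)
      have h' : (N : ℝ) ^ ((1 : ℝ) / 4) / (1 / 4) = 4 * (N : ℝ) ^ ((1 : ℝ) / 4) := by ring
      linarith
    have hsq : (N : ℝ) ^ ((1 : ℝ) / 4) * (N : ℝ) ^ ((1 : ℝ) / 4) = Real.sqrt N := by
      rw [← Real.rpow_add hN0, Real.sqrt_eq_rpow]; norm_num
    have hsqrt4 : 4 ≤ Real.sqrt N := by
      rw [show (4 : ℝ) = Real.sqrt 16 by
        rw [show (16 : ℝ) = 4 ^ 2 by norm_num, Real.sqrt_sq (by norm_num)]]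
      exact Real.sqrt_le_sqrt hN16
    have hNsq : Real.sqrt N * Real.sqrt N = N := Real.mul_self_sqrt hN0.le
    have hYL : Y * Real.log N ≤ 4 * N := by
      calc Y * Real.log N ≤ (2 * (N : ℝ) ^ ((1 : ℝ) / 4)) * (4 * (N : ℝ) ^ ((1 : ℝ) / 4)) :=
            mul_le_mul (by linarith) hL4 hL0.le (by positivity)
        _ = 8 * Real.sqrt N := by rw [← hsq]; ring
        _ ≤ 2 * (Real.sqrt N * Real.sqrt N) := by nlinarith
        _ = 2 * N := by rw [hNsq]
        _ ≤ 4 * N := by linarith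
    rw [div_le_div_iff₀ hN0 hL0]
    calc Y / Real.log Y * Real.log N * Real.log N = Y * (Real.log N / Real.log Y) * Real.log N := by ring
      _ ≤ Y * u * Real.log N := by gcongr
      _ = u * (Y * Real.log N) := by ring
      _ ≤ u * (4 * N) := by gcongr
      _ ≤ u * (u * N) := by gcongr
      _ = (u : ℝ) ^ 2 * N := by ring
  have huv : (u : ℝ) - Real.log N / Real.log Y ≤ (u : ℝ) ^ 2 / Real.log N := by
    have h1 : (u : ℝ) - Real.log N / Real.log Y = (u * Real.log Y - Real.log N) / Real.log Y := by
      field_simp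
    have h2 : u * Real.log Y - Real.log N ≤ u := by
      have h3 := mul_le_mul_of_nonneg_left hℓ2 hu0.le
      have h4 : (u : ℝ) * (Real.log N / u + 1) = Real.log N + u := by field_simp
      linarith
    rw [h1]
    calc (u * Real.log Y - Real.log N) / Real.log Y ≤ u / Real.log Y :=
          div_le_div_of_nonneg_right h2 hℓ0.le
      _ ≤ u / (Real.log N / u) := div_le_div_of_nonneg_left hu0.le hLu0 hℓ1.le
      _ = (u : ℝ) ^ 2 / Real.log N := by field_simp
  have hv3 : (3 : ℝ) ≤ Real.log N / Real.log Y := by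
    have : (u : ℝ) ^ 2 / Real.log N ≤ 1 := by rw [div_le_one hL0]; exact huN
    linarith
  -- the rate bound multiplied by `log N / N`
  have hLN : 0 < Real.log N / N := div_pos hL0 hN0
  have hmain : |(cell u N (i + 1) : ℝ) * Real.log N / N -
      (cellDensity i (Real.log N / Real.log Y) -
        (if i = 0 then Y / Real.log Y else 0) * Real.log N / N)| ≤
      A ^ (2 * u) * (u : ℝ) ^ 2 / Real.log N := by
    have hident : (cell u N (i + 1) : ℝ) * Real.log N / N -
        (cellDensity i (Real.log N / Real.log Y) -
          (if i = 0 then Y / Real.log Y else 0) * Real.log N / N) =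
        ((cell u N (i + 1) : ℝ) - ((N : ℝ) * cellDensity i (Real.log N / Real.log Y) / Real.log N -
          (if i = 0 then Y / Real.log Y else 0))) * (Real.log N / N) := by
      field_simp
    rw [hident, abs_mul, abs_of_pos hLN]
    calc _ ≤ A ^ (i + u + 1) * N / Real.log Y ^ 2 * (Real.log N / N) :=
          mul_le_mul_of_nonneg_right hRate hLN.le
      _ = A ^ (i + u + 1) * Real.log N / Real.log Y ^ 2 := by field_simp
      _ ≤ A ^ (2 * u) * (u : ℝ) ^ 2 / Real.log N := hE1
  -- `A^{2u} ≥ 1`, so `A^{2u} u²/L + 2 u²/L ≤ 3 A^{2u} u²/L`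
  have hU0 : 0 ≤ (u : ℝ) ^ 2 / Real.log N := by positivity
  have hA2u : (u : ℝ) ^ 2 / Real.log N ≤ A ^ (2 * u) * (u : ℝ) ^ 2 / Real.log N := by
    rw [mul_div_assoc]
    exact le_mul_of_one_le_left hU0 (one_le_pow₀ hA1)
  rcases i with _ | j
  · -- `m = 1`: `I_1 ≡ 1`, secondary prime term present
    simp only [cellDensity_zero, if_true] at hmain ⊢
    have hS0 : 0 ≤ Y / Real.log Y * Real.log N / N := by positivity
    calc |(cell u N (0 + 1) : ℝ) * Real.log N / N - 1|
        ≤ |(cell u N (0 + 1) : ℝ) * Real.log N / N - (1 - Y / Real.log Y * Real.log N / N)| +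
          |Y / Real.log Y * Real.log N / N| := by
          have := abs_sub_le ((cell u N (0 + 1) : ℝ) * Real.log N / N)
            (1 - Y / Real.log Y * Real.log N / N) 1
          rwa [show (1 - Y / Real.log Y * Real.log N / N) - 1 = -(Y / Real.log Y * Real.log N / N) by ring,
            abs_neg] at this
      _ ≤ A ^ (2 * u) * (u : ℝ) ^ 2 / Real.log N + (u : ℝ) ^ 2 / Real.log N := by
          rw [abs_of_nonneg hS0]; exact add_le_add hmain hE2
      _ ≤ 3 * A ^ (2 * u) * (u : ℝ) ^ 2 / Real.log N := by
          have : 3 * A ^ (2 * u) * (u : ℝ) ^ 2 / Real.log N =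
            A ^ (2 * u) * (u : ℝ) ^ 2 / Real.log N + A ^ (2 * u) * (u : ℝ) ^ 2 / Real.log N +
              A ^ (2 * u) * (u : ℝ) ^ 2 / Real.log N := by ring
          rw [this]; linarith [hA2u, hU0]
  · -- `m = j + 2`: no secondary term; move the density from `v` to `u`
    simp only [Nat.succ_ne_zero, if_false, zero_mul, zero_div, sub_zero] at hmain
    have hMVT : |cellDensity (j + 1) (Real.log N / Real.log Y) - cellDensity (j + 1) u| ≤
        (u : ℝ) - Real.log N / Real.log Y := by
      have hconv : Convex ℝ (Set.Ici (3 : ℝ)) := convex_Ici 3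
      have hder : ∀ x ∈ Set.Ici (3 : ℝ), HasDerivWithinAt (cellDensity (j + 1))
          (cellDensity j (x - 1) / (x - 1)) (Set.Ici 3) x := fun x hx =>
        (calc_hasDerivAt j (by linarith [Set.mem_Ici.mp hx])).hasDerivWithinAt
      have hbound : ∀ x ∈ Set.Ici (3 : ℝ), ‖cellDensity j (x - 1) / (x - 1)‖ ≤ 1 := fun x hx => by
        rw [Real.norm_eq_abs]
        exact anatomyAlong_abs_cellDensity_div_le_one j (by linarith [Set.mem_Ici.mp hx])
      have h := hconv.norm_image_sub_le_of_norm_hasDerivWithin_le hder hbound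
        (Set.mem_Ici.mpr hv3) (Set.mem_Ici.mpr (by linarith : (3 : ℝ) ≤ u))
      rw [Real.norm_eq_abs, Real.norm_eq_abs, one_mul,
        abs_of_nonneg (by linarith : 0 ≤ (u : ℝ) - Real.log N / Real.log Y)] at h
      rwa [abs_sub_comm]
    calc |(cell u N (j + 1 + 1) : ℝ) * Real.log N / N - cellDensity (j + 1) u|
        ≤ |(cell u N (j + 1 + 1) : ℝ) * Real.log N / N - cellDensity (j + 1) (Real.log N / Real.log Y)| +
          |cellDensity (j + 1) (Real.log N / Real.log Y) - cellDensity (j + 1) u| := abs_sub_le _ _ _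
      _ ≤ A ^ (2 * u) * (u : ℝ) ^ 2 / Real.log N + (u : ℝ) ^ 2 / Real.log N :=
          add_le_add hmain (hMVT.trans huv)
      _ ≤ 3 * A ^ (2 * u) * (u : ℝ) ^ 2 / Real.log N := by
          have : 3 * A ^ (2 * u) * (u : ℝ) ^ 2 / Real.log N =
            A ^ (2 * u) * (u : ℝ) ^ 2 / Real.log N + A ^ (2 * u) * (u : ℝ) ^ 2 / Real.log N +
              A ^ (2 * u) * (u : ℝ) ^ 2 / Real.log N := by ring
          rw [this]; linarith [hA2u, hU0]

end Summit.Parity.GeneralizedHardyLittlewood.Cruxes.AbsoluteUpgrade.DipMarginRateExchange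

end
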